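import Summits.ABC.IUTFork.Cor312ThetaSideClosedM
import HarnessLib

/-!
# [IUTchIII] Corollary 3.12 at the M-LEVEL sharp setting of the datum's OWN Θ-ideles — the mint's «(or =)» for the READ
# binder `hΘ`, first half: `−|log(Θ)|(setting) ≤ ↑(NONARCHIMEDEAN part of the genuine number)`, hence `<`, NEVER `=`

PROOF-ONLY record file (D-0012; no definitions, no `Prop` facts) of the abc-iut cell (R2 S-chain team, seat abc-iut-s2-p8,
gen 3; branch C «abc ⇐ S», C-lead ruling C-R12 (e) «target #2′: the M-level (V̲, K_{v̲}) real volume setting»; director's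
mint 2026-08-26T07:39:27Z, TARGET #2: «prove `(settingPrVolSharp …).negLogTheta ≤ ↑I.negLogTheta` (or =)»). TAKES NO SIDE
on [IUTchIII] Cor. 3.12.

The `≤` half is this seat's G1-Θ closer (`Cor312ThetaSideClosedM`, p440655: `negLogTheta_settingMSharp_tOfIdeleData_le_genuine`,
NO Θ-side hypothesis). THIS file records the honest answer to «(or =)» against abc-iut-S2's FULL genuine number
`I.negLogTheta = I.negLogThetaNonarch + ((l+5)/4)·log π` (`GenuineLogTheta`): the typed `−|log(Θ)|` of the M-level sharp
setting of the datum's own Θ-ideles is bounded by the NONARCHIMEDEAN part alone — abc-iut-w5-d166's assembly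
`negLogTheta_le_genuine_of_local_bounds` (`Cor312ThetaSideAssemblyM`, p438195) run with the archimedean summand `A := 0`
(the cell's real settings carry the TRIVIAL archimedean container: abc-iut-s2-p9's `thetaLocal_settingMSharp_arc = 0`), at the
PROVED local inputs (hA) `thetaLocal_settingMSharp_tOfIdeleData_le_orbitSumM` (p440655) and (hlow)
`thetaLocal_settingMSharp_tOfIdeleData_eq_zero` (p438889) — so that

* `negLogTheta_le_negLogThetaNonarch_of_local_bounds` (generic, any setting over `thetaIndexOfInitial D`, from (h∞)/(hA)/(hlow));
* **`negLogTheta_settingMSharp_tOfIdeleData_le_negLogThetaNonarch`**: `−|log(Θ)|(settingMSharp … (tOfIdeleData D r) …) ≤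
  ↑(volumeInputOf D r).negLogThetaNonarch` (the READ bound SHARPENED by `archLogTheta l`);
* **`negLogTheta_settingMSharp_tOfIdeleData_lt_genuine`** / **`…_ne_genuine`**: `−|log(Θ)|(setting) < ↑(volumeInputOf D r).negLogTheta`
  — the «=» form of `hΘ` is FALSE AT EVERY DATUM (slack `≥ archLogTheta l = ((l+5)/4)·log π > 0`, abc-iut-S2 `archLogTheta_pos`);
* the summand-route twins at this seat's `settingPrVolSharpM` (p438078; same number, abc-iut-w4-d013's two-routes identity) and the
  forms for a volume input `I` with `IsVolumeInputOf D I` (abc-iut-w5-d033 `negLogTheta_eq_ideleDataOf`).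

The second half of «(or =)» — EQUALITY with the nonarchimedean part (abc-iut-s2-p9's question (N1), STATUS 11:15:50Z /
11:18:22Z) — is the companion files' business (factorwise orbit span; `thetaLocal = orbitSumM`).
[cite: Mochizuki2012, IUTchIII Cor. 3.12 p. 173–174] [cite: Mochizuki2012, IUTchIV Thm. 1.10 Steps (v)–(viii) p. 27–31]
[cite: DupuyHilado2025, §1 (1.1), Def. 3.6.3, §4.11–4.12] [claim: Mochizuki2012, status: disputed] for every quoted construction.
HONEST FRAMING: inequalities between OUR typed `−|log(Θ)|` of OUR typed M-level setting and abc-iut-S2's DEFINED numbers for the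
same genuine input; `<` records that the setting's trivial archimedean container does not model the printed archimedean
summand of [IUTchIV] Thm. 1.10 Step (vii) — a statement about the cell's typing, not about any author; nothing here asserts or
denies [IUTchIII] Cor. 3.12 (`Cor312.Setting.Statement` untouched); typed ≠ proved; instantiated ≠ endorsed.
-/

noncomputable section

open Set Function NumberField IsDedekindDomain
open scoped Classical

namespace Summit.ABC.IUTFork.Thm311.Real

open Cor312 Cor312Vol Literature.IUT.LogThetaLattice Literature.IUT.LogVolume Literature.IUT.HodgeTheaters
  Literature.NumberTheory.NumberFields

variable {F K Fbar : Type} [Field F] [NumberField F] [Field K] [NumberField K] [Algebra F K]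
  [Field Fbar] [Algebra F Fbar] [Algebra K Fbar] {E : WeierstrassCurve F} [E.IsElliptic] {l : ℕ}
  {Pb : BadPlacePredicates K} (D : InitialThetaData F K Fbar E l Pb) (r : ThetaData.IdeleData D)

/-! ## §1. The assembly with the archimedean summand `A := 0` (generic over the M-level index skeleton) -/

section Generic

variable {S : Situation (thetaIndexOfInitial D)} (P : Cor312.Setting S)

/-- **G1-Θ ASSEMBLED at the M level, NONARCHIMEDEAN form.** For ANY setting `P` of [IUTchIII] Cor. 3.12 over the index skeleton of
the initial Θ-data `D` and the genuine Θ-volume input of idele data `r`: if (h∞) the local Θ-volumes vanish at the archimedean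
place, (hA) are bounded by the orbit sums at every finite place and label, and (hlow) are nonnegative at the finite places outside
the support `T(I)`, then `P.negLogTheta ≤ ↑(volumeInputOf D r).negLogThetaNonarch` — abc-iut-w5-d166's
`negLogTheta_le_genuine_of_local_bounds` with the archimedean summand `A := 0` in unit (R) `negLogTheta_le_sum_add` (the genuine
archimedean closed form `((l+5)/4)·log π` is simply not added). [cite: Mochizuki2012, IUTchIV Thm. 1.10 Steps (v)–(viii) p. 27–31] -/
theorem negLogTheta_le_negLogThetaNonarch_of_local_bounds
    (harc : ∀ (i : Fin (thetaIndexOfInitial D).lstar) (w : InfinitePlace ℚ),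
      P.thetaLocal (Cor312.Setting.labelSucc i) (Val.arc w) = ((0 : ℝ) : WithTop ℝ))
    (hA : ∀ (i : Fin (thetaIndexOfInitial D).lstar) (u : FinitePlace ℚ),
      P.thetaLocal (Cor312.Setting.labelSucc i) (Val.non u) ≤ ((orbitSumM D r i u : ℝ) : WithTop ℝ))
    (hlow : ∀ (i : Fin (thetaIndexOfInitial D).lstar) (u : FinitePlace ℚ),
      ratChar u ∉ (ThetaData.volumeInputOf D r).supportPrimes →
        ((0 : ℝ) : WithTop ℝ) ≤ P.thetaLocal (Cor312.Setting.labelSucc i) (Val.non u)) :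
    P.negLogTheta ≤ (((ThetaData.volumeInputOf D r).negLogThetaNonarch : ℝ) : WithTop ℝ) := by
  set I := ThetaData.volumeInputOf D r with hI
  -- the finite set of places of `ℚ` under the support, one per prime
  let φ : {q // q ∈ I.supportPrimes} → (thetaIndexOfInitial D).VQ :=
    fun q => Val.non (placeOfPrimeQ q.1 (I.prime_of_mem_supportPrimes q.2))
  have hφ : Function.Injective φ := by
    intro q q' h
    have h1 : placeOfPrimeQ q.1 (I.prime_of_mem_supportPrimes q.2) =
        placeOfPrimeQ q'.1 (I.prime_of_mem_supportPrimes q'.2) := Sum.inr_injective h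
    apply Subtype.ext
    rw [← ratChar_placeOfPrimeQ q.1 (I.prime_of_mem_supportPrimes q.2), h1,
      ratChar_placeOfPrimeQ q'.1 (I.prime_of_mem_supportPrimes q'.2)]
  let Tset : Finset (thetaIndexOfInitial D).VQ := Finset.univ.image φ
  -- the local bounds: orbit sums at finite places, `0` at the archimedean place
  let b : Fin (thetaIndexOfInitial D).lstar → (thetaIndexOfInitial D).VQ → ℝ := fun i vQ =>
    match vQ with
    | .inr u => orbitSumM D r i u
    | .inl _ => 0
  have hle : ∀ (i : Fin (thetaIndexOfInitial D).lstar), ∀ vQ ∈ Tset,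
      P.thetaLocal (Cor312.Setting.labelSucc i) vQ ≤ ((b i vQ : ℝ) : WithTop ℝ) := by
    intro i vQ hvQ
    obtain ⟨q, -, rfl⟩ := Finset.mem_image.mp hvQ
    exact hA i _
  have hzero : ∀ (i : Fin (thetaIndexOfInitial D).lstar) (vQ : (thetaIndexOfInitial D).VQ), vQ ∉ Tset →
      P.thetaLocal (Cor312.Setting.labelSucc i) vQ = ((0 : ℝ) : WithTop ℝ) := by
    intro i vQ hvQ
    rcases vQ with w | u
    · exact harc i w
    · have hu : ratChar u ∉ I.supportPrimes := by
        intro hmem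
        apply hvQ
        refine Finset.mem_image.mpr ⟨⟨ratChar u, hmem⟩, Finset.mem_univ _, ?_⟩
        show Val.non (placeOfPrimeQ (ratChar u) _) = Val.non u
        rw [placeOfPrimeQ_ratChar u]
      exact thetaLocal_eq_zero_of_not_mem_support D r P u hu (fun i' => hA i' u) (fun i' => hlow i' u hu) i
  have hmain := P.negLogTheta_le_sum_add Tset b (le_refl (0 : ℝ)) hzero hle
  -- the place sum of the averaged orbit sums is the nonarchimedean part of the genuine number
  have hsum : (∑ vQ ∈ Tset, (1 / ((thetaIndexOfInitial D).lstar : ℝ)) * ∑ i : Fin (thetaIndexOfInitial D).lstar, b i vQ) =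
      I.negLogThetaNonarch := by
    rw [Finset.sum_image fun q _ q' _ h => hφ h, ThetaVolumeInput.negLogThetaNonarch,
      ← Finset.sum_attach I.supportPrimes]
    refine Finset.sum_congr rfl fun q _ => ?_
    show (1 / ((thetaIndexOfInitial D).lstar : ℝ)) *
        ∑ i, orbitSumM D r i (placeOfPrimeQ q.1 (I.prime_of_mem_supportPrimes q.2)) = I.negLogThetaLoc q.1
    rw [procAvg_orbitSumM_eq_negLogThetaLoc, ratChar_placeOfPrimeQ]
  rw [hsum, add_zero] at hmain
  exact hmain

/-- From the nonarchimedean bound, the STRICT inequality against the full genuine number: `P.negLogTheta < ↑(volumeInputOf D r).negLogTheta`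
(`negLogTheta = negLogThetaNonarch + archLogTheta l`, `archLogTheta l > 0`). [cite: Mochizuki2012, IUTchIV Thm. 1.10 Step (vii) p. 30] -/
theorem negLogTheta_lt_genuine_of_le_negLogThetaNonarch
    (h : P.negLogTheta ≤ (((ThetaData.volumeInputOf D r).negLogThetaNonarch : ℝ) : WithTop ℝ)) :
    P.negLogTheta < (((ThetaData.volumeInputOf D r).negLogTheta : ℝ) : WithTop ℝ) := by
  refine lt_of_le_of_lt h (WithTop.coe_lt_coe.mpr ?_)
  show (ThetaData.volumeInputOf D r).negLogThetaNonarch <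
    (ThetaData.volumeInputOf D r).negLogThetaNonarch + ThetaVolumeInput.archLogTheta (ThetaData.volumeInputOf D r).l
  exact lt_add_of_pos_right _ (ThetaVolumeInput.archLogTheta_pos _)

end Generic

/-! ## §2. At the sharp settings of the datum's own Θ-ideles: `≤ nonarch`, `<`, `≠` -/

section Setting

variable {logvK : PadicLogsVal K} (hlog : LogvAnalyticVal logvK)
  (tq : ∀ (u : FinitePlace ℚ) (x : (thetaIndexOfInitial D).Fibre (Val.non u)),
    kOfM D (ratChar u) u (natCast_ratChar_mem u) x)
  (M : Type) [Field M] [NumberField M]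
  (archPk : ∀ (j : (thetaIndexOfInitial D).Label) (vQ : (thetaIndexOfInitial D).VQ),
    Set ((logShellsOfInitialDH D logvK).Packet j vQ))
  (archSub : ∀ (j : (thetaIndexOfInitial D).Label) (v : (thetaIndexOfInitial D).V),
    Set ((logShellsOfInitialDH D logvK).Packet j ((thetaIndexOfInitial D).over v)))
  (Ψ : ℤ → ∀ v : (thetaIndexOfInitial D).V, v ∈ (thetaIndexOfInitial D).Vbad →
    Set ((logShellsOfInitialDH D logvK).StarPacket v))
  (act : ℤ → ∀ v : (thetaIndexOfInitial D).V, v ∈ (thetaIndexOfInitial D).Vbad →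
    (logShellsOfInitialDH D logvK).StarPacket v → Module.End ℚ ((logShellsOfInitialDH D logvK).StarPacket v))
  (Mmod : ℤ → ∀ j : (thetaIndexOfInitial D).LabelStar, Set ((logShellsOfInitialDH D logvK).GlobalPacket j.1))
  (region : ℤ → ∀ j : (thetaIndexOfInitial D).LabelStar, FinDivisor M → ∀ vQ : (thetaIndexOfInitial D).VQ,
    Set ((logShellsOfInitialDH D logvK).Packet j.1 vQ))
  (n : ℤ) {HT : Type} {LogLink : HT → HT → Type} {IsFull : ∀ {s t : HT}, LogLink s t → Prop}
  (lat : LGPGaussianLogThetaLattice LogLink IsFull)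
  {Frd : Type} {IsoF : Frd → Frd → Type} {Ob : Frd → Type} {realify : Frd → Frd} {Strip : Type}
  {IsoS : Strip → Strip → Type}
  {Mv : ∀ v : (thetaIndexOfInitial D).V, v ∈ (thetaIndexOfInitial D).Vbad → Type} [∀ v h, Monoid (Mv v h)]
  (sig : GlobalLGPFrobenioidSignature (thetaIndexOfInitial D).lstar (thetaIndexOfInitial D).V
    (· ∈ (thetaIndexOfInitial D).Vbad) Frd IsoF Ob realify Strip IsoS Mv)
  (split : SplittingMonoids Mv) {ObΔ : Type}
  {N : ∀ v : (thetaIndexOfInitial D).V, v ∈ (thetaIndexOfInitial D).Vbad → Type} [∀ v h, Monoid (N v h)]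
  (qData : QPilotData ObΔ N)
  (htq0 : ∀ u x, tq u x ≠ 0) (Sq : Finset (FinitePlace ℚ))
  (htq1 : ∀ (u : FinitePlace ℚ) (x : (thetaIndexOfInitial D).Fibre (Val.non u)), u ∉ Sq → ‖tq u x‖ = 1)

/-- **`−|log(Θ)|` of the frames-route M-level sharp setting of the datum's OWN Θ-ideles is at most the NONARCHIMEDEAN part of
abc-iut-S2's genuine number**: `(settingMSharp … (tOfIdeleData D r) tq htq0 Sq htq1).negLogTheta ≤ ↑(volumeInputOf D r).negLogThetaNonarch`
— NO residual hypothesis ((h∞) abc-iut-s2-p9 `thetaLocal_settingMSharp_arc`, (hA) this seat's p440655, (hlow) abc-iut-w5-d166's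
`thetaLocal_settingMSharp_tOfIdeleData_eq_zero`). Sharper than the READ binder `hΘ` by `archLogTheta l`.
[cite: Mochizuki2012, IUTchIII Cor. 3.12 p. 173–174] -/
theorem negLogTheta_settingMSharp_tOfIdeleData_le_negLogThetaNonarch :
    (settingMSharp D hlog M archPk archSub Ψ act Mmod region n lat sig split qData (tOfIdeleData D r) tq htq0 Sq htq1).negLogTheta ≤
      (((ThetaData.volumeInputOf D r).negLogThetaNonarch : ℝ) : WithTop ℝ) :=
  negLogTheta_le_negLogThetaNonarch_of_local_bounds D r _
    (fun i w => thetaLocal_settingMSharp_arc D hlog M archPk archSub Ψ act Mmod region n lat sig split qData (tOfIdeleData D r)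
      tq htq0 Sq htq1 (Setting.labelSucc i) w)
    (fun i u => thetaLocal_settingMSharp_tOfIdeleData_le_orbitSumM D hlog r tq M archPk archSub Ψ act Mmod region n lat sig split
      qData htq0 Sq htq1 i u)
    (fun i u hu => (thetaLocal_settingMSharp_tOfIdeleData_eq_zero D hlog r M archPk archSub Ψ act Mmod region n lat sig split
      qData tq htq0 Sq htq1 i u hu).symm.le)

/-- **The «=» form of `hΘ` FAILS at every datum (frames route)**: `−|log(Θ)|(settingMSharp … (tOfIdeleData D r) …) < ↑(volumeInputOf D r).negLogTheta`
— the genuine number exceeds the setting's by at least the archimedean closed form `((l+5)/4)·log π > 0` of [IUTchIV] Thm. 1.10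
Step (vii), which the setting's trivial archimedean container does not carry. [cite: Mochizuki2012, IUTchIV Thm. 1.10 Step (vii) p. 30] -/
theorem negLogTheta_settingMSharp_tOfIdeleData_lt_genuine :
    (settingMSharp D hlog M archPk archSub Ψ act Mmod region n lat sig split qData (tOfIdeleData D r) tq htq0 Sq htq1).negLogTheta <
      (((ThetaData.volumeInputOf D r).negLogTheta : ℝ) : WithTop ℝ) :=
  negLogTheta_lt_genuine_of_le_negLogThetaNonarch D r _
    (negLogTheta_settingMSharp_tOfIdeleData_le_negLogThetaNonarch D r hlog tq M archPk archSub Ψ act Mmod region n lat sig split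
      qData htq0 Sq htq1)

/-- **… so `−|log(Θ)|(setting) ≠ ↑(volumeInputOf D r).negLogTheta`** — «(or =)» answered in the negative against the FULL genuine number
(frames route). [cite: Mochizuki2012, IUTchIII Cor. 3.12 p. 173–174] -/
theorem negLogTheta_settingMSharp_tOfIdeleData_ne_genuine :
    (settingMSharp D hlog M archPk archSub Ψ act Mmod region n lat sig split qData (tOfIdeleData D r) tq htq0 Sq htq1).negLogTheta ≠
      (((ThetaData.volumeInputOf D r).negLogTheta : ℝ) : WithTop ℝ) :=
  (negLogTheta_settingMSharp_tOfIdeleData_lt_genuine D r hlog tq M archPk archSub Ψ act Mmod region n lat sig split qData htq0 Sq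
    htq1).ne

/-- **Summand route**: `−|log(Θ)|(settingPrVolSharpM … (tOfIdeleData D r) …) ≤ ↑(volumeInputOf D r).negLogThetaNonarch` (this seat's
`settingPrVolSharpM`, p438078; same number as the frames route, `negLogTheta_settingMSharp_eq_settingPrVolSharpM`).
[cite: Mochizuki2012, IUTchIII Cor. 3.12 p. 173–174] -/
theorem negLogTheta_settingPrVolSharpM_tOfIdeleData_le_negLogThetaNonarch :
    (settingPrVolSharpM D hlog (tOfIdeleData D r) tq M archPk archSub Ψ act Mmod region n lat sig split qData htq0 Sq
        htq1).negLogTheta ≤ (((ThetaData.volumeInputOf D r).negLogThetaNonarch : ℝ) : WithTop ℝ) := by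
  rw [← negLogTheta_settingMSharp_eq_settingPrVolSharpM]
  exact negLogTheta_settingMSharp_tOfIdeleData_le_negLogThetaNonarch D r hlog tq M archPk archSub Ψ act Mmod region n lat sig split
    qData htq0 Sq htq1

/-- **Summand route, «=» fails**: `−|log(Θ)|(settingPrVolSharpM … (tOfIdeleData D r) …) < ↑(volumeInputOf D r).negLogTheta`.
[cite: Mochizuki2012, IUTchIV Thm. 1.10 Step (vii) p. 30] -/
theorem negLogTheta_settingPrVolSharpM_tOfIdeleData_lt_genuine :
    (settingPrVolSharpM D hlog (tOfIdeleData D r) tq M archPk archSub Ψ act Mmod region n lat sig split qData htq0 Sq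
        htq1).negLogTheta < (((ThetaData.volumeInputOf D r).negLogTheta : ℝ) : WithTop ℝ) :=
  negLogTheta_lt_genuine_of_le_negLogThetaNonarch D r _
    (negLogTheta_settingPrVolSharpM_tOfIdeleData_le_negLogThetaNonarch D r hlog tq M archPk archSub Ψ act Mmod region n lat sig
      split qData htq0 Sq htq1)

/-- **Summand route, `≠`.** [cite: Mochizuki2012, IUTchIII Cor. 3.12 p. 173–174] -/
theorem negLogTheta_settingPrVolSharpM_tOfIdeleData_ne_genuine :
    (settingPrVolSharpM D hlog (tOfIdeleData D r) tq M archPk archSub Ψ act Mmod region n lat sig split qData htq0 Sq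
        htq1).negLogTheta ≠ (((ThetaData.volumeInputOf D r).negLogTheta : ℝ) : WithTop ℝ) :=
  (negLogTheta_settingPrVolSharpM_tOfIdeleData_lt_genuine D r hlog tq M archPk archSub Ψ act Mmod region n lat sig split qData
    htq0 Sq htq1).ne

/-- **For a volume input `I` of `D`** (`IsVolumeInputOf D I`; abc-iut-w5-d033 `negLogTheta_eq_ideleDataOf`): at the frames-route M-level
sharp setting of `I`'s own Θ-ideles, `−|log(Θ)| < ↑I.negLogTheta` — the binder `hΘ : … ≤ ↑I.negLogTheta` of `Conditional/AbcOfS*.lean`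
is never an equality. [cite: Mochizuki2012, IUTchIII Cor. 3.12 p. 173–174] -/
theorem negLogTheta_settingMSharp_lt_of_isVolumeInputOf {I : ThetaVolumeInput (fieldOfModuli E) K}
    (hI : ThetaData.IsVolumeInputOf D I) :
    (settingMSharp D hlog M archPk archSub Ψ act Mmod region n lat sig split qData (tOfIdeleData D (ideleDataOf D hI)) tq htq0
        Sq htq1).negLogTheta < ((I.negLogTheta : ℝ) : WithTop ℝ) := by
  rw [negLogTheta_eq_ideleDataOf D hI]
  exact negLogTheta_settingMSharp_tOfIdeleData_lt_genuine D (ideleDataOf D hI) hlog tq M archPk archSub Ψ act Mmod region n lat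
    sig split qData htq0 Sq htq1

/-- **For a volume input `I` of `D`, `≠`.** [cite: Mochizuki2012, IUTchIII Cor. 3.12 p. 173–174] -/
theorem negLogTheta_settingMSharp_ne_of_isVolumeInputOf {I : ThetaVolumeInput (fieldOfModuli E) K}
    (hI : ThetaData.IsVolumeInputOf D I) :
    (settingMSharp D hlog M archPk archSub Ψ act Mmod region n lat sig split qData (tOfIdeleData D (ideleDataOf D hI)) tq htq0
        Sq htq1).negLogTheta ≠ ((I.negLogTheta : ℝ) : WithTop ℝ) :=
  (negLogTheta_settingMSharp_lt_of_isVolumeInputOf D hlog tq M archPk archSub Ψ act Mmod region n lat sig split qData htq0 Sq htq1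
    hI).ne

end Setting

end Summit.ABC.IUTFork.Thm311.Real

end
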